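import Summits.CriticalPhenomena.PercolationContinuityZ3.Theorems.PercNearOneGluingNoHeavyLowerTailSahiOneStepFibreF3CheckComplete
import Summits.CriticalPhenomena.PercolationContinuityZ3.Theorems.PercNearOneGluingNoHeavyLowerTailSahiOneStepFibreF3Reduce
import Mathlib.Algebra.Order.Ring.GeomSum
import Mathlib.Data.Real.Basic
import HarnessLib

/-!
# One-step scheme: SOUNDNESS of the checker for the three-copy fibre forms (part 2)

Support file (prover prim-ineq-prove-3 gen 16; `--supports stmt-CriticalPhenomena-4575`; memo
`run/shared/lean/prim/prim-ineq-prove-3/FINDING-G16-FIBRE-MAJ5.md` §3.6, §3.8).  No definitions, no named facts, no sorries, no `native_decide`.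

* codes and masks (`…FibreF3CheckDefs`): `testBit_code`, `code_injective`, `testBit_maskOf` (bit `code S` of `maskOf U` is `[S ∈ U]`);
* **completeness** `maskOf_mem_upMasks`: the mask of every upper family of `P(range n)` is listed by `upMasks n` (induction on `n`: a family splits into
  its members avoiding `n` and the traces of its members containing `n`, both upper, the first contained in the second);
* **soundness** `checkSlow_sound`, `checkFive_sound`: if the checker accepts `(d1, d2, θ)` then `f3sum ℤ (range d1) (Ico d1 (d1+d2)) θ 1_U 1_V ≥ 0` for all
  masks `U, V` in `upMasks (d1+d2)` (`f3sum_indMask_eq`: the form of two mask indicators is the quadruple-data sum; `prog_eq`: the table evaluation of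
  the program is that sum; `maskSum_split` for the two-level enumeration of `checkFive`);
* `f3sum_upper_nonneg_nat_real`: hence, GIVEN the checks (run by `native_decide` in `…FibreF3CheckLeFour` / `…FibreF3CheckFiveD*`), the forms with
  `d1 + d2 ≤ 5` are `≥ 0` over `ℝ` on all pairs of upper families of `P(range (d1+d2))` (thresholds `0` and `> d1+d2` vanish identically).
-/

namespace Summit.CriticalPhenomena.PercolationContinuityZ3.Theorems

namespace SahiOneStep

open Finset

/-! ## Soundness of the checker -/

/-- Array accessor of `Array.ofFn`. -/
theorem getD_ofFn {n : ℕ} (f : Fin n → ℤ) {i : ℕ} (h : i < n) : (Array.ofFn f).getD i 0 = f ⟨i, h⟩ := by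
  simp [Array.getD_eq_getD_getElem?, h]

/-- `maskSum` as a `Finset.sum`. -/
theorem maskSum_eq (k m : ℕ) (r : Array ℤ) (off : ℕ) :
    maskSum k m r off = ∑ c ∈ Finset.range k, bitR ℤ m c * r.getD (c + off) 0 := by
  unfold maskSum
  induction k with
  | zero => simp
  | succ k ih =>
    rw [List.range_succ, List.foldl_append, List.foldl_cons, List.foldl_nil, ih, Finset.sum_range_succ]
    by_cases h : m.testBit k = true
    · simp [bitR, h]
    · simp [bitR, h]

/-- The `f3term` of mask indicators in terms of the quadruple data. -/
theorem f3term_indMask (D₁ D₂ : Finset ℕ) (θ : ℕ) (mU mV : ℕ) (q : (Finset ℕ × Finset ℕ) × (Finset ℕ × Finset ℕ)) :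
    f3term ℤ D₁ D₂ θ (indMask ℤ mU) (indMask ℤ mV) q =
      bitR ℤ mU (code (f3S1 D₂ q)) * ((thrR ℤ θ (f3S1 D₂ q) * (1 - thrR ℤ θ (f3S0 D₂ q))) * bitR ℤ mV (code (f3S1 D₂ q)) +
        (thrR ℤ θ (f3S1 D₂ q) * thrR ℤ θ (f3S2 D₁ q) + thrR ℤ θ (f3S0 D₂ q) - thrR ℤ θ (f3S1 D₂ q) - thrR ℤ θ (f3S2 D₁ q)) *
          bitR ℤ mV (code (f3S2 D₁ q))) := by
  unfold f3term indMask bitR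
  ring

/-- **The fibre form of two mask indicators is the quadruple-data sum.** -/
theorem f3sum_indMask_eq (d1 d2 θ : ℕ) (mU mV : ℕ) :
    f3sum ℤ (Finset.range d1) (Finset.Ico d1 (d1 + d2)) θ (indMask ℤ mU) (indMask ℤ mV) =
      ∑ x ∈ qdata d1 d2 θ, bitR ℤ mU x.2.1 * (x.2.2.2.1 * bitR ℤ mV x.2.1 + x.2.2.2.2 * bitR ℤ mV x.2.2.1) := by
  unfold f3sum qdata
  rw [Finset.sum_image]
  · exact Finset.sum_congr rfl fun q _ => f3term_indMask _ _ θ mU mV q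
  · intro q _ q' _ h
    exact (Prod.ext_iff.1 h).1

/-- Codes in the quadruple data are `< 2^(d1+d2)`. -/
theorem qdata_code_lt {d1 d2 θ : ℕ} {x : (((Finset ℕ × Finset ℕ) × (Finset ℕ × Finset ℕ))) × ℕ × ℕ × ℤ × ℤ}
    (hx : x ∈ qdata d1 d2 θ) : x.2.1 < 2 ^ (d1 + d2) ∧ x.2.2.1 < 2 ^ (d1 + d2) := by
  unfold qdata at hx
  obtain ⟨q, hq, rfl⟩ := Finset.mem_image.1 hx
  have hD : Finset.range d1 ∪ Finset.Ico d1 (d1 + d2) = Finset.range (d1 + d2) := by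
    ext i; simp only [Finset.mem_union, Finset.mem_range, Finset.mem_Ico]; omega
  have h1 := f3S1_subset hq
  have h2 := f3S2_subset hq
  rw [hD] at h1 h2
  exact ⟨code_lt_two_pow h1, code_lt_two_pow h2⟩

/-- **The optimized evaluation equals the quadruple-data sum.** -/
theorem prog_eq (Q : Finset ((((Finset ℕ × Finset ℕ) × (Finset ℕ × Finset ℕ))) × ℕ × ℕ × ℤ × ℤ)) (N : ℕ)
    (hQ : ∀ x ∈ Q, x.2.1 < N ∧ x.2.2.1 < N) (mU mV : ℕ) :
    ∑ c₁ ∈ Finset.range N, bitR ℤ mU c₁ * (bitR ℤ mV c₁ * Bdiag Q c₁ + ∑ c₂ ∈ Finset.range N, bitR ℤ mV c₂ * Aentry Q c₁ c₂) =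
      ∑ x ∈ Q, bitR ℤ mU x.2.1 * (x.2.2.2.1 * bitR ℤ mV x.2.1 + x.2.2.2.2 * bitR ℤ mV x.2.2.1) := by
  -- expand the coefficients and move the sum over `Q` outside
  have hB : ∀ c₁ ∈ Finset.range N, bitR ℤ mU c₁ * (bitR ℤ mV c₁ * Bdiag Q c₁) =
      ∑ x ∈ Q, (if x.2.1 = c₁ then bitR ℤ mU x.2.1 * (x.2.2.2.1 * bitR ℤ mV x.2.1) else 0) := by
    intro c₁ _
    unfold Bdiag
    rw [Finset.mul_sum, Finset.mul_sum]
    refine Finset.sum_congr rfl fun x _ => ?_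
    by_cases h : x.2.1 = c₁
    · rw [if_pos h, if_pos h, h]; ring
    · rw [if_neg h, if_neg h]; ring
  have hA : ∀ c₁ ∈ Finset.range N, bitR ℤ mU c₁ * ∑ c₂ ∈ Finset.range N, bitR ℤ mV c₂ * Aentry Q c₁ c₂ =
      ∑ x ∈ Q, (if x.2.1 = c₁ then bitR ℤ mU x.2.1 * (x.2.2.2.2 * bitR ℤ mV x.2.2.1) else 0) := by
    intro c₁ _
    unfold Aentry
    have : ∀ c₂ ∈ Finset.range N, bitR ℤ mV c₂ * ∑ x ∈ Q, (if x.2.1 = c₁ ∧ x.2.2.1 = c₂ then x.2.2.2.2 else 0) =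
        ∑ x ∈ Q, (if x.2.1 = c₁ then (if x.2.2.1 = c₂ then bitR ℤ mV x.2.2.1 * x.2.2.2.2 else 0) else 0) := by
      intro c₂ _
      rw [Finset.mul_sum]
      refine Finset.sum_congr rfl fun x _ => ?_
      by_cases h1 : x.2.1 = c₁
      · by_cases h2 : x.2.2.1 = c₂
        · rw [if_pos ⟨h1, h2⟩, if_pos h1, if_pos h2, h2]
        · rw [if_neg (fun h => h2 h.2), if_pos h1, if_neg h2, mul_zero]
      · rw [if_neg (fun h => h1 h.1), if_neg h1, mul_zero]
    rw [Finset.sum_congr rfl this, Finset.sum_comm]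
    rw [Finset.mul_sum]
    refine Finset.sum_congr rfl fun x hx => ?_
    by_cases h1 : x.2.1 = c₁
    · simp only [if_pos h1]
      rw [Finset.sum_ite_eq (Finset.range N) x.2.2.1, if_pos (Finset.mem_range.2 (hQ x hx).2), h1]
      ring
    · simp only [if_neg h1, Finset.sum_const_zero, mul_zero]
  calc ∑ c₁ ∈ Finset.range N, bitR ℤ mU c₁ * (bitR ℤ mV c₁ * Bdiag Q c₁ + ∑ c₂ ∈ Finset.range N, bitR ℤ mV c₂ * Aentry Q c₁ c₂)
      = ∑ c₁ ∈ Finset.range N, (∑ x ∈ Q, ((if x.2.1 = c₁ then bitR ℤ mU x.2.1 * (x.2.2.2.1 * bitR ℤ mV x.2.1) else 0) +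
          (if x.2.1 = c₁ then bitR ℤ mU x.2.1 * (x.2.2.2.2 * bitR ℤ mV x.2.2.1) else 0))) := by
        refine Finset.sum_congr rfl fun c₁ hc₁ => ?_
        rw [mul_add, hB c₁ hc₁, hA c₁ hc₁, ← Finset.sum_add_distrib]
    _ = ∑ x ∈ Q, ∑ c₁ ∈ Finset.range N, ((if x.2.1 = c₁ then bitR ℤ mU x.2.1 * (x.2.2.2.1 * bitR ℤ mV x.2.1) else 0) +
          (if x.2.1 = c₁ then bitR ℤ mU x.2.1 * (x.2.2.2.2 * bitR ℤ mV x.2.2.1) else 0)) := Finset.sum_comm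
    _ = ∑ x ∈ Q, bitR ℤ mU x.2.1 * (x.2.2.2.1 * bitR ℤ mV x.2.1 + x.2.2.2.2 * bitR ℤ mV x.2.2.1) := by
        refine Finset.sum_congr rfl fun x hx => ?_
        rw [Finset.sum_add_distrib, Finset.sum_ite_eq (Finset.range N) x.2.1, Finset.sum_ite_eq (Finset.range N) x.2.1,
          if_pos (Finset.mem_range.2 (hQ x hx).1), if_pos (Finset.mem_range.2 (hQ x hx).1)]
        ring

/-- The inner evaluation of the checkers: with the arrays `A, B, r` as in the program, `maskSum N U r 0` is the fibre form. -/
theorem eval_eq (d1 d2 θ : ℕ) (mU mV : ℕ) :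
    let N := 2 ^ (d1 + d2)
    let Q := qdata d1 d2 θ
    let A : Array ℤ := Array.ofFn (n := N * N) fun k => Aentry Q (k.val / N) (k.val % N)
    let B : Array ℤ := Array.ofFn (n := N) fun k => Bdiag Q k.val
    let r : Array ℤ := Array.ofFn (n := N) fun c₁ => bitR ℤ mV c₁.val * B.getD c₁.val 0 + maskSum N mV A (c₁.val * N)
    maskSum N mU r 0 = f3sum ℤ (Finset.range d1) (Finset.Ico d1 (d1 + d2)) θ (indMask ℤ mU) (indMask ℤ mV) := by
  intro N Q A B r
  have hN : 0 < N := Nat.two_pow_pos _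
  rw [f3sum_indMask_eq, ← prog_eq Q N (fun x hx => qdata_code_lt hx) mU mV, maskSum_eq]
  refine Finset.sum_congr rfl fun c₁ hc₁ => ?_
  have hc₁N : c₁ < N := Finset.mem_range.1 hc₁
  rw [Nat.add_zero, getD_ofFn _ hc₁N]
  simp only
  rw [getD_ofFn _ hc₁N, maskSum_eq]
  congr 2
  refine Finset.sum_congr rfl fun c₂ hc₂ => ?_
  have hc₂N : c₂ < N := Finset.mem_range.1 hc₂
  have hk : c₂ + c₁ * N < N * N := by nlinarith
  rw [getD_ofFn _ hk]
  simp only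
  rw [show (c₂ + c₁ * N) / N = c₁ by rw [Nat.add_mul_div_right _ _ hN, Nat.div_eq_of_lt hc₂N, zero_add],
    show (c₂ + c₁ * N) % N = c₂ by rw [Nat.add_mul_mod_self_right, Nat.mod_eq_of_lt hc₂N]]

/-- `eval_eq` with the table size as a parameter. -/
theorem eval_eq' (d1 d2 θ N : ℕ) (hN : 2 ^ (d1 + d2) = N) (mU mV : ℕ) :
    let Q := qdata d1 d2 θ
    let A : Array ℤ := Array.ofFn (n := N * N) fun k => Aentry Q (k.val / N) (k.val % N)
    let B : Array ℤ := Array.ofFn (n := N) fun k => Bdiag Q k.val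
    let r : Array ℤ := Array.ofFn (n := N) fun c₁ => bitR ℤ mV c₁.val * B.getD c₁.val 0 + maskSum N mV A (c₁.val * N)
    maskSum N mU r 0 = f3sum ℤ (Finset.range d1) (Finset.Ico d1 (d1 + d2)) θ (indMask ℤ mU) (indMask ℤ mV) := by
  subst hN
  exact eval_eq d1 d2 θ mU mV

/-- Splitting a mask sum over 32 bits into the low and high 16 bits. -/
theorem maskSum_split {m₀ : ℕ} (hm₀ : m₀ < 2 ^ 16) (m₁ : ℕ) (r : Array ℤ) :
    maskSum 32 (m₀ + 2 ^ (2 ^ 4) * m₁) r 0 = maskSum 16 m₀ r 0 + maskSum 16 m₁ r 16 := by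
  rw [maskSum_eq, maskSum_eq, maskSum_eq, show (32 : ℕ) = 16 + 16 from rfl, Finset.sum_range_add]
  congr 1
  · refine Finset.sum_congr rfl fun c hc => ?_
    have hc16 : c < 16 := Finset.mem_range.1 hc
    simp only [bitR]
    rw [show m₀ + 2 ^ (2 ^ 4) * m₁ = 2 ^ 16 * m₁ + m₀ by ring, Nat.testBit_two_pow_mul_add m₁ hm₀, if_pos hc16]
  · refine Finset.sum_congr rfl fun c _ => ?_
    simp only [bitR]
    rw [show m₀ + 2 ^ (2 ^ 4) * m₁ = 2 ^ 16 * m₁ + m₀ by ring, Nat.testBit_two_pow_mul_add m₁ hm₀]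
    have hnc : ¬ (16 + c < 16) := by omega
    rw [if_neg hnc, Nat.add_sub_cancel_left, Nat.add_zero, Nat.add_comm 16 c]

/-- Elements of a list are indexed. -/
theorem exists_index_of_mem {l : List ℕ} {a : ℕ} (h : a ∈ l) : ∃ i, i < l.length ∧ l.getD i 0 = a := by
  obtain ⟨i, hi, rfl⟩ := List.getElem_of_mem h
  exact ⟨i, hi, by rw [List.getD_eq_getElem?_getD, List.getElem?_eq_getElem hi, Option.getD_some]⟩

/-- **Soundness of the fast checker** (five free coordinates). -/
theorem checkFive_sound {d1 θ : ℕ} (hd : d1 ≤ 5) (h : checkFive d1 θ = true) {mU mV : ℕ} (hU : mU ∈ upMasks 5)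
    (hV : mV ∈ upMasks 5) : 0 ≤ f3sum ℤ (Finset.range d1) (Finset.Ico d1 5) θ (indMask ℤ mU) (indMask ℤ mV) := by
  have h5 : d1 + (5 - d1) = 5 := by omega
  obtain ⟨u₁, hu₁, u₀, hu₀, hbu, rfl⟩ := (mem_upMasks_succ (n := 4)).1 hU
  obtain ⟨v₁, hv₁, v₀, hv₀, hbv, rfl⟩ := (mem_upMasks_succ (n := 4)).1 hV
  obtain ⟨i₀, hi₀, hi₀e⟩ := exists_index_of_mem hu₀
  obtain ⟨i₁, hi₁, hi₁e⟩ := exists_index_of_mem hu₁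
  obtain ⟨j₀, hj₀, hj₀e⟩ := exists_index_of_mem hv₀
  obtain ⟨j₁, hj₁, hj₁e⟩ := exists_index_of_mem hv₁
  have hmemP : ∀ {a₀ a₁ : ℕ}, a₀ < (upMasks 4).length → a₁ < (upMasks 4).length →
      bitSubset (2 ^ 4) ((upMasks 4).getD a₀ 0) ((upMasks 4).getD a₁ 0) = true → (a₀, a₁) ∈ upPairs 4 := by
    intro a₀ a₁ ha₀ ha₁ hb
    unfold upPairs
    simp only [List.mem_flatMap, List.mem_map, List.mem_filter, List.mem_range]
    exact ⟨a₁, ha₁, a₀, ⟨ha₀, hb⟩, rfl⟩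
  have hii : (i₀, i₁) ∈ upPairs 4 := hmemP hi₀ hi₁ (by rw [hi₀e, hi₁e]; exact hbu)
  have hjj : (j₀, j₁) ∈ upPairs 4 := hmemP hj₀ hj₁ (by rw [hj₀e, hj₁e]; exact hbv)
  unfold checkFive at h
  simp only [List.all_eq_true, decide_eq_true_eq] at h
  have h' := h (j₀, j₁) hjj (i₀, i₁) hii
  simp only at h'
  rw [getD_ofFn _ hi₀, getD_ofFn _ hi₁] at h'
  simp only at h'
  rw [hi₀e, hi₁e, hj₀e, hj₁e] at h'
  have hu₀lt : u₀ < 2 ^ 16 := lt_of_mem_upMasks hu₀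
  rw [← maskSum_split hu₀lt] at h'
  have hev := eval_eq' d1 (5 - d1) θ 32 (by rw [h5]; rfl) (u₀ + 2 ^ (2 ^ 4) * u₁) (v₀ + 2 ^ (2 ^ 4) * v₁)
  simp only at hev
  rw [h5] at hev
  rw [← hev]
  exact h'

/-- **Soundness of the slow checker.** -/
theorem checkSlow_sound {d1 d2 θ : ℕ} (h : checkSlow d1 d2 θ = true) {mU mV : ℕ} (hU : mU ∈ upMasks (d1 + d2))
    (hV : mV ∈ upMasks (d1 + d2)) : 0 ≤ f3sum ℤ (Finset.range d1) (Finset.Ico d1 (d1 + d2)) θ (indMask ℤ mU) (indMask ℤ mV) := by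
  have := eval_eq d1 d2 θ mU mV
  simp only at this
  rw [← this]
  unfold checkSlow at h
  simp only [List.all_eq_true, decide_eq_true_eq] at h
  exact h mV hV mU hU

/-! ## From masks back to families; the edge thresholds; the integer form over `ℤ` and over a ring -/

/-- The indicator of a family is the indicator of its mask. -/
theorem indF_eq_indMask (R : Type*) [Zero R] [One R] (U : Finset (Finset ℕ)) :
    (fun S => if S ∈ U then (1 : R) else 0) = indMask R (maskOf U) := by
  funext S
  simp only [indMask, testBit_maskOf, decide_eq_true_eq]

section Edge
variable {κ : Type*} [DecidableEq κ] {R : Type*} [CommRing R]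

/-- Threshold `0`: the form vanishes termwise. -/
theorem f3sum_theta_zero (D₁ D₂ : Finset κ) (u v : Finset κ → R) : f3sum R D₁ D₂ 0 u v = 0 := by
  unfold f3sum
  refine Finset.sum_eq_zero fun q _ => ?_
  simp only [f3term, thrR, Nat.zero_le, if_true]
  ring

/-- Threshold above the number of free coordinates: the form vanishes termwise. -/
theorem f3sum_theta_large (D₁ D₂ : Finset κ) {θ : ℕ} (hθ : (D₁ ∪ D₂).card < θ) (u v : Finset κ → R) : f3sum R D₁ D₂ θ u v = 0 := by
  unfold f3sum
  refine Finset.sum_eq_zero fun q hq => ?_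
  have h0 : ¬ θ ≤ (f3S0 D₂ q).card := fun h => absurd (h.trans (Finset.card_le_card (f3S0_subset hq))) (not_le.2 hθ)
  have h1 : ¬ θ ≤ (f3S1 D₂ q).card := fun h => absurd (h.trans (Finset.card_le_card (f3S1_subset hq))) (not_le.2 hθ)
  have h2 : ¬ θ ≤ (f3S2 D₁ q).card := fun h => absurd (h.trans (Finset.card_le_card (f3S2_subset hq))) (not_le.2 hθ)
  simp only [f3term, thrR, h0, h1, h2, if_false]
  ring

/-- The form over `ℤ` maps to the form over any ring. -/
theorem map_f3sum (φ : ℤ →+* R) (D₁ D₂ : Finset κ) (θ : ℕ) (u v : Finset κ → ℤ) :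
    φ (f3sum ℤ D₁ D₂ θ u v) = f3sum R D₁ D₂ θ (fun S => φ (u S)) (fun S => φ (v S)) := by
  unfold f3sum
  rw [map_sum]
  refine Finset.sum_congr rfl fun q _ => ?_
  have hthr : ∀ S : Finset κ, φ (thrR ℤ θ S) = thrR R θ S := fun S => by
    unfold thrR; split_ifs <;> simp
  simp only [f3term, map_add, map_sub, map_mul, map_one, hthr]

end Edge

/-- **The fibre forms on at most five free coordinates are nonnegative on all pairs of upper families of `P(range (d1+d2))`**, given the checks.
[this work] -/
theorem f3sum_upper_nonneg_nat {d1 d2 : ℕ} (hd : d1 + d2 ≤ 5) (θ : ℕ)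
    (hchk4 : d1 + d2 ≤ 4 → 1 ≤ θ → θ ≤ d1 + d2 → checkSlow d1 d2 θ = true)
    (hchk5 : d1 + d2 = 5 → 1 ≤ θ → θ ≤ 5 → checkFive d1 θ = true)
    (U V : Finset (Finset ℕ)) (hU : U ⊆ (Finset.range (d1 + d2)).powerset)
    (hUup : ∀ S ∈ U, ∀ T ∈ (Finset.range (d1 + d2)).powerset, S ⊆ T → T ∈ U) (hV : V ⊆ (Finset.range (d1 + d2)).powerset)
    (hVup : ∀ S ∈ V, ∀ T ∈ (Finset.range (d1 + d2)).powerset, S ⊆ T → T ∈ V) :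
    0 ≤ f3sum ℤ (Finset.range d1) (Finset.Ico d1 (d1 + d2)) θ (fun S => if S ∈ U then 1 else 0) (fun S => if S ∈ V then 1 else 0) := by
  rw [indF_eq_indMask ℤ U, indF_eq_indMask ℤ V]
  have hmU := maskOf_mem_upMasks (d1 + d2) U hU hUup
  have hmV := maskOf_mem_upMasks (d1 + d2) V hV hVup
  by_cases hθ0 : θ = 0
  · rw [hθ0, f3sum_theta_zero]
  by_cases hθd : d1 + d2 < θ
  · have hD : (Finset.range d1 ∪ Finset.Ico d1 (d1 + d2)).card < θ := by
      have : Finset.range d1 ∪ Finset.Ico d1 (d1 + d2) = Finset.range (d1 + d2) := by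
        ext i; simp only [Finset.mem_union, Finset.mem_range, Finset.mem_Ico]; omega
      rw [this, Finset.card_range]; exact hθd
    rw [f3sum_theta_large _ _ hD]
  have h1 : 1 ≤ θ := Nat.one_le_iff_ne_zero.2 hθ0
  have h2 : θ ≤ d1 + d2 := not_lt.1 hθd
  by_cases hd4 : d1 + d2 ≤ 4
  · exact checkSlow_sound (hchk4 hd4 h1 h2) hmU hmV
  · have hd5 : d1 + d2 = 5 := by omega
    have h5 := checkFive_sound (d1 := d1) (θ := θ) (by omega) (hchk5 hd5 h1 (hd5 ▸ h2)) (hd5 ▸ hmU) (hd5 ▸ hmV)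
    rw [hd5]; exact h5

/-- The same over `ℝ`: via the ring map `ℤ → ℝ`. -/
theorem f3sum_upper_nonneg_nat_real {d1 d2 : ℕ} (hd : d1 + d2 ≤ 5) (θ : ℕ)
    (hchk4 : d1 + d2 ≤ 4 → 1 ≤ θ → θ ≤ d1 + d2 → checkSlow d1 d2 θ = true)
    (hchk5 : d1 + d2 = 5 → 1 ≤ θ → θ ≤ 5 → checkFive d1 θ = true)
    (U V : Finset (Finset ℕ)) (hU : U ⊆ (Finset.range (d1 + d2)).powerset)
    (hUup : ∀ S ∈ U, ∀ T ∈ (Finset.range (d1 + d2)).powerset, S ⊆ T → T ∈ U) (hV : V ⊆ (Finset.range (d1 + d2)).powerset)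
    (hVup : ∀ S ∈ V, ∀ T ∈ (Finset.range (d1 + d2)).powerset, S ⊆ T → T ∈ V) :
    (0 : ℝ) ≤ f3sum ℝ (Finset.range d1) (Finset.Ico d1 (d1 + d2)) θ (fun S => if S ∈ U then 1 else 0) (fun S => if S ∈ V then 1 else 0) := by
  have h := f3sum_upper_nonneg_nat hd θ hchk4 hchk5 U V hU hUup hV hVup
  have hmap := map_f3sum (Int.castRingHom ℝ) (Finset.range d1) (Finset.Ico d1 (d1 + d2)) θ (fun S => if S ∈ U then 1 else 0)
    (fun S => if S ∈ V then 1 else 0)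
  simp only [eq_intCast, Int.cast_ite, Int.cast_one, Int.cast_zero] at hmap
  rw [← hmap]
  exact_mod_cast h

end SahiOneStep

end Summit.CriticalPhenomena.PercolationContinuityZ3.Theorems
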